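import Summits.QuantumFields.BalabanUV.T4Continuum.Support.NE9SpeciesDataOfRecord

/-!
# NE9SpeciesDataOfRecordAdmissible — the END's species binders `hD ∕ hK` (`CurData.Admissible`, `KerData.Admissible`) at the
# DATA OF RECORD (`NE9SpeciesDataOfRecord`, generation 36) REDUCED TO THEIR ANALYTIC CLAUSES: the frame clauses `srcScale ∕ G1 ∕
# d0_nonneg` are discharged by construction (`d₀ = 21203`), so `Admissible` of the curve species of record ⇐ {`κ₁ ≥ 1`, `r_k > 0`,
# `R_X > 0`, THE SLICE-CURVE ANALYTICITY `cur_an` ([I] Lemma 4 (3.53)), `ϱ > 1`, the gain `ϱ⁻¹ ≤ c_dir·ℓ`, `c_dir ≥ 0`} and of the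
# kernel species of record ⇐ {`κ₁ ≥ 1`, `r_k > 0`, `R_X > 0`, `KerZero`, THE SUMMAND BOUND `kerBound` ([I] (4.21)–(4.22)), the points'
# geometry `geom ∕ sum0 ∕ sum1`, nonnegativities} — the exact list of what stays DISPLAYED for species (a)∕(b) at the data of record
# (cell `pub-balaban`, T4-DAG §2 node U3 ∕ §6 NE9; BINDER row NE9 OWNER lineage `b2b-balaban-t4-ne9-p1`, generation 36; nothing of any
# import modified)

HONEST FRAMING (T4-DAG PAGE 1).  Rung (B)+1 of the FINITE-VOLUME T⁴ programme — NOT infinite volume, NOT a mass gap, NOT the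
Clay problem.  NE9 (`T4OutputRate.NE9` ∧ `FadingMemory`) is a cell NEW ESTIMATE, NOT PRINTED in [I] = [Balaban1987RG1]
(CMP **109**), [II] = [Balaban1988RG2Cluster] (CMP **116**), and NOT PROVED for Bałaban's E^{(j)} («NE9 ⇐ the named binders»;
spine PROVED 0∕9).  HONEST DEPENDENCY (cell line, verbatim): continuum YM on T⁴ ⇐ BetaPertH ∧ nine spine estimates (0/9 proved);
BetaPertH ⇐ (D1) ∧ (D4) ∧ CAP+tail; G-an2-4 gates asym, D1 and NE2/3/4.  `FlowStep.BetaPertH`, (B), (B^μ) do not occur.  Two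
structure constructors; the analytic clauses are HYPOTHESES here, displayed in the tree's own binder shapes and never asserted for any
object of the series (ABSOLUTE RULE); 0 sorry.

WHAT.  * **`admissible_curDataOfRecord`** — `(curDataOfRecord R Yout κ₁ r Rad cur ϱ).Admissible ℓ cdir 21203` from the seven analytic
∕ letter clauses, the frame clauses supplied by `srcScale_curDataOfRecord` ∕ `G1_curDataOfRecord`;
* **`admissible_kerDataOfRecord`** — `(kerDataOfRecord R Yout κ₁ r Rad pts p0 dX ρd m ker).Admissible ℓ gain cK δ₀ δ₁ w w0 c0 c1 21203`
from `KerZero`, `kerBound`, `geom`, `sum0`, `sum1` and the letters, the frame clauses supplied likewise.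
So at the data of record the END's `hD U ∕ hK U` READ: (a) [I] Lemma 4 (3.53) p. 280 «The functions in (3.53) are analytic on the above
spaces» as `cur_an` + the radii letters ((3.54)–(3.55)); (b) [I] p. 286 summand bound as `kerBound` + (G)∕(S) (crew `NE9KernelGeometry*`
∕ `NE9LatticeExpSums` supply (G)∕(S) for the torus points of record once `pts ∕ p0 ∕ dX ∕ ρd` are those).  DISGUISE TEST: two `where`
blocks; nothing estimated.

References (TYPES ∕ loci only): [Balaban1987RG1] T. Bałaban, CMP **109** (1987) 249–301, Lemma 4 (3.53)–(3.55) p. 280, (4.17)–(4.22)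
pp. 285–286; [Balaban1988RG2Cluster] T. Bałaban, CMP **116** (1988) 1–22, (1.25) p. 7.  Summits-side NEW work (LEAN PLACEMENT RULE);
imports `NE9SpeciesDataOfRecord` (generation 36) ONLY; modifies nothing.  Value = the species T-rows at the data of record isolated
by name, NOT summit progress.
-/

noncomputable section

namespace Summit.QuantumFields.BalabanUV.T4Continuum.NE9SpeciesDataOfRecordAdmissible

open Metric Set Complex
open Literature.MathematicalPhysics.QuantumFieldTheory.Balaban1983to89
open Literature.MathematicalPhysics.QuantumFieldTheory.Balaban1983to89.T4OutputRate (Carriers)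
open Summit.QuantumFields.BalabanUV.T4Continuum.B13Carriers (TwoRuns)
open Summit.QuantumFields.BalabanUV.T4Continuum.B13DomainGeometryTR
open Summit.QuantumFields.BalabanUV.T4Continuum.NE9ComplexEncoding (doubleCarriers)
open Summit.QuantumFields.BalabanUV.T4Continuum.NE9Lemma1RemainderSpecies (OnContour)
open Summit.QuantumFields.BalabanUV.T4Continuum.NE9Lemma1CurveSpecies
open Summit.QuantumFields.BalabanUV.T4Continuum.NE9Lemma1KernelSpecies
open Summit.QuantumFields.BalabanUV.T4Continuum.NE9SpeciesFrameOfRecord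
open Summit.QuantumFields.BalabanUV.T4Continuum.NE9SpeciesDataOfRecord

variable {G : Type} [GaugeGroup G] (R : TwoRuns G) {E ι Pt : Type} [NormedAddCommGroup E] [NormedSpace ℂ E]
  (Yout : ℕ → ι → R.carriers.Dom) (κ₁ : ℝ) (r : ℕ → ℝ) (Rad : R.carriers.Dom → ℝ)

/-! ## §1 The curve species of record: `Admissible` from its analytic clauses -/

section Cur

variable
  (cur : ℕ → (ℕ → ℝ) → ι → SCube R → Finset (SCube R) → (doubleCarriers R.carriers).Dom → ℂ → (SCube R → ℝ) →
    (SCube R → ℂ) → ℂ → E)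
  (ϱ : ℕ → (ℕ → ℝ) → ι → SCube R → Finset (SCube R) → (doubleCarriers R.carriers).Dom → ℝ)

/-- **`hD` AT THE DATA OF RECORD, REDUCED**: `Admissible ℓ cdir 21203` of the curve species of record from `κ₁ ≥ 1`, `r_k > 0`,
`R_X > 0`, the slice-curve analyticity WITH DOMAIN INCLUSION on the contours ([I] Lemma 4 (3.53) p. 280 — a HYPOTHESIS here, in the
tree's `cur_an` shape at the cube lists of record), `ϱ > 1`, the gain `ϱ⁻¹ ≤ c_dir·ℓ k j` on the index frame of record ((3.54)–(3.55)),
`c_dir ≥ 0`; the frame clauses `srcScale ∕ G1 ∕ d0_nonneg` are discharged by construction.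
[cite: Balaban1987RG1, (3.53)-(3.55) p.280; Balaban1988RG2Cluster, (1.25) p.7] -/
theorem admissible_curDataOfRecord {ℓ : ℕ → ℕ → ℝ} {cdir : ℝ} (hκ₁ : 1 ≤ κ₁) (hr : ∀ k, 0 < r k) (hRad : ∀ X, 0 < Rad X)
    (hcur : ∀ (k : ℕ) (s : ℕ → ℝ) (y : ι) (a : SCube R) (b : Finset (SCube R)) (x : (doubleCarriers R.carriers).Dom),
      ∀ t ∈ sphere (0:ℂ) (r k), ∀ (s' : SCube R → ℝ) (σ' : SCube R → ℂ), OnContour κ₁ (cubesList R k a b) s' σ' →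
        DifferentiableOn ℂ (cur k s y a b x t s' σ') (ball 0 (ϱ k s y a b x)) ∧
          MapsTo (cur k s y a b x t s' σ') (ball 0 (ϱ k s y a b x)) (ball 0 (Rad x.1)))
    (hϱ_gt : ∀ k s y a b x, 1 < ϱ k s y a b x)
    (hϱ_inv : ∀ (k : ℕ) (s : ℕ → ℝ) (y : ι), ∀ a ∈ boxes R k (Yout k y), ∀ b ∈ families R k (Yout k y) a, ∀ (j : ℕ),
      ∀ x ∈ sources R k a j, (ϱ k s y a b x)⁻¹ ≤ cdir * ℓ k j)
    (hcdir : 0 ≤ cdir) :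
    (curDataOfRecord R Yout κ₁ r Rad cur ϱ).Admissible ℓ cdir 21203 where
  κ₁_ge := hκ₁
  r_pos := hr
  R_pos := hRad
  cur_an := hcur
  ϱ_gt := hϱ_gt
  ϱ_inv_le := hϱ_inv
  srcScale := srcScale_curDataOfRecord R Yout κ₁ r Rad cur ϱ
  G1 := G1_curDataOfRecord R Yout κ₁ r Rad cur ϱ
  d0_nonneg := by norm_num
  cdir_nonneg := hcdir

end Cur

/-! ## §2 The kernel species of record: `Admissible` from its analytic ∕ geometric clauses -/

section Ker

variable (pts : ℕ → ι → SCube R → Finset Pt) (p0 : R.carriers.Dom → Pt) (dX : R.carriers.Dom → Pt → ℝ) (ρd : Pt → Pt → ℝ)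
  (m : ℕ)
  (ker : ℕ → (ℕ → ℝ) → ι → SCube R → Finset (SCube R) → (doubleCarriers R.carriers).Dom → ℂ → (SCube R → ℝ) →
    (SCube R → ℂ) → Pt → Pt → (E → ℂ) → ℂ)

/-- **`hK` AT THE DATA OF RECORD, REDUCED**: `Admissible ℓ gain cK δ₀ δ₁ w w0 c0 c1 21203` of the kernel species of record from
`κ₁ ≥ 1`, `r_k > 0`, `R_X > 0`, `KerZero`, the summand bound **(K)** on the contours for analytic bounded `F` ([I] (4.21)–(4.22)
p. 286 — a HYPOTHESIS here, in the tree's `kerBound` shape at the index frame and cube lists of record), the points' geometry **(G)**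
and lattice sums **(S)** (displayed), and the letters' nonnegativity; the frame clauses `srcScale ∕ G1 ∕ d0_nonneg` are discharged
by construction. [cite: Balaban1987RG1, (4.17)-(4.22) pp.285-286; Balaban1988RG2Cluster, (1.25) p.7] -/
theorem admissible_kerDataOfRecord {ℓ gain : ℕ → ℕ → ℝ} {cK δ₀ δ₁ w w0 c0 c1 : ℝ} (hκ₁ : 1 ≤ κ₁) (hr : ∀ k, 0 < r k)
    (hRad : ∀ X, 0 < Rad X)
    (hzero : ∀ k s y a b x t s' σ' p q, ker k s y a b x t s' σ' p q (0 : E → ℂ) = 0)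
    (hker : ∀ (k : ℕ) (s : ℕ → ℝ) (y : ι), ∀ a ∈ boxes R k (Yout k y), ∀ b ∈ families R k (Yout k y) a, ∀ (j : ℕ),
      ∀ x ∈ sources R k a j, ∀ t ∈ sphere (0:ℂ) (r k), ∀ (s' : SCube R → ℝ) (σ' : SCube R → ℂ),
        OnContour κ₁ (cubesList R k a b) s' σ' → ∀ p ∈ pts k y a, ∀ q ∈ pts k y a, ∀ (F : E → ℂ) (M : ℝ),
          DifferentiableOn ℂ F (ball 0 (Rad x.1)) → (∀ z ∈ ball (0:E) (Rad x.1), ‖F z‖ ≤ M) →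
            ‖ker k s y a b x t s' σ' p q F‖ ≤ cK * M * gain k j * ρd p q ^ m * Real.exp (-(δ₀ * (dX x.1 p + dX x.1 q))))
    (hgeom : ∀ (k : ℕ) (y : ι) (a : SCube R) (x : (doubleCarriers R.carriers).Dom), ∀ p ∈ pts k y a, ∀ q ∈ pts k y a,
      δ₁ * ρd (p0 x.1) p + δ₁ * ρd p q ≤ δ₀ * (dX x.1 p + dX x.1 q) + w * R.carriers.d x.1 + w0)
    (hsum0 : ∀ (k : ℕ) (y : ι) (a : SCube R) (X : R.carriers.Dom), ∑ p ∈ pts k y a, Real.exp (-(δ₁ * ρd (p0 X) p)) ≤ c0)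
    (hsum1 : ∀ (k : ℕ) (y : ι) (a : SCube R), ∀ p ∈ pts k y a, ∑ q ∈ pts k y a, ρd p q ^ m * Real.exp (-(δ₁ * ρd p q)) ≤ c1)
    (hcK : 0 ≤ cK) (hgain : ∀ k j, 0 ≤ gain k j) (hρd : ∀ p q, 0 ≤ ρd p q) (hc0 : 0 ≤ c0) (hc1 : 0 ≤ c1) :
    (kerDataOfRecord R Yout κ₁ r Rad pts p0 dX ρd m ker).Admissible ℓ gain cK δ₀ δ₁ w w0 c0 c1 21203 where
  κ₁_ge := hκ₁
  r_pos := hr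
  R_pos := hRad
  kerZero := hzero
  kerBound := hker
  geom := hgeom
  sum0 := hsum0
  sum1 := hsum1
  srcScale := srcScale_kerDataOfRecord R Yout κ₁ r Rad pts p0 dX ρd m ker
  G1 := G1_kerDataOfRecord R Yout κ₁ r Rad pts p0 dX ρd m ker
  d0_nonneg := by norm_num
  cK_nonneg := hcK
  gain_nonneg := hgain
  ρd_nonneg := hρd
  c0_nonneg := hc0
  c1_nonneg := hc1

end Ker

end Summit.QuantumFields.BalabanUV.T4Continuum.NE9SpeciesDataOfRecordAdmissible

end
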